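import Literature.NumberTheory.CubicFields.ShintaniZetaResidues
import Literature.NumberTheory.CubicFields.SingularZeroTransport
import Mathlib.Analysis.SpecialFunctions.Complex.CircleAddChar
import HarnessLib

/-!
# The dual side of Shintani's zeta functions: `Φ̂_m`, the dual coefficients `a^±(|Φ̂_m|, n)`, the density `δ̂₁(Φ_m)` (BTT (eq:FT), (18)); Theorem 3.2 and Proposition 5.1 as hypothesis schemas

Topic `Literature/NumberTheory/CubicFields`; built on `ShintaniZeta.lean` (`shintaniCoeffWith w D`, the
`1/|Stab|`-weighted orbit sum; `shintaniCoeffMod`), `ShintaniZetaResidues.lean` (`shintaniRes1`, `shintaniRes56`,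
the residues of the continuation) and `NonFundCountShintaniCoeff.lean` (`psiMod q = Ψ_{q²}`).

Bhargava–Taniguchi–Thorne 2023, §2.4: "The dual zeta functions `ξ^{*,±}(s, Ψ_m)` are defined, for each
`GL₂(ℤ/mℤ)`-invariant `Ψ_m : V*(ℤ/mℤ) → ℂ`, by a variant of (12): the sum is now over all `GL₂(ℤ)`-orbits in the
dual lattice `V*(ℤ)`. … there is a `GL₂(ℤ)`-equivariant embedding `ι : V*(ℤ) ↪ V(ℤ)`, whose image consists of
those binary cubic forms whose middle two coefficients are divisible by `3`. Following Shintani, we identify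
`V*(ℤ)` with its image in `V(ℤ)`, and define the discriminant of an element of `V*(ℤ)` via this embedding. We define
`Φ̂_m(x) := m⁻⁴ Σ_{y ∈ V(ℤ/mℤ)} Φ_m(y) exp(2πi·[x, y]/m)` (eq:FT) and lift `Φ̂_m` to a function on `V*(ℤ)`. We use
`ι` to regard `Φ̂_m` as a function on `V(ℤ)`, and write `Φ̂_m(x) = 0` for all `x ∈ V(ℤ)` not in the image of `ι`."
Thm 3.1 (18): "`δ̂₁(Φ_m) := m⁴ · sup_N N⁻¹ Σ_{α∈{±}} Σ_{n<N} a^α(|Φ̂_m|, n)`", (17): "`N^±(X, Φ_m) := Σ_{n<X} a^±(Φ_m, n)`".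

Shintani's identification `ι` is the one induced by his alternating form
`⟨x, y⟩ = x₄y₁ − ⅓x₃y₂ + ⅓x₂y₃ − x₁y₄` on `V` (coefficients of `u³, u²v, uv², v³`), for which the lattice dual to
`V(ℤ)` is exactly `{3 ∣ b, 3 ∣ c}` and `⟨γ·x, γ·y⟩ = (det γ)⁵ ⟨x, y⟩` for the twisted action (8) (`dualPairing_twist`):
so for `f = (a, b, c, d) ∈ V(ℤ)` with `3 ∣ b, c` the dual vector `ι⁻¹ f` is `y ↦ ⟨f, y⟩ = d·y_a − (c/3)·y_b + (b/3)·y_c − a·y_d`.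

This file DEFINES (no facts)
* `dualPairing f y = ⟨f, y⟩ ∈ ℤ/mℤ` for `f ∈ V(ℤ)`, `y ∈ V(ℤ/mℤ)`; `IsDualForm f` (`3 ∣ b ∧ 3 ∣ c`, the image of `ι`);
* `fourierDual Φ f = Φ̂_m(ι⁻¹ f) = m⁻⁴ Σ_y Φ(y) e(⟨f, y⟩/m)` ((eq:FT); `e(t/m)` written `eMod`, which is Mathlib's
  `ZMod.stdAddChar` for `m ≥ 1`, `eMod_eq_stdAddChar`);
* `dualWeight Φ f = |Φ̂_m(ι⁻¹ f)|` on the image of `ι` and `0` off it; it is `GL₂(ℤ)`-INVARIANT for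
  `GL₂(ℤ/mℤ)`-invariant `Φ` (`dualWeight_twist` — the point of Shintani's `ι`), so that
* `dualAbsCoeff Φ α n = a^α(|Φ̂_m|, n) := shintaniCoeffWith (dualWeight Φ) (α·n)`, the `1/|Stab|`-weighted sum over
  the `GL₂(ℤ)`-orbits of discriminant `α n` (BTT's dual coefficients of `|Φ̂_m|`), is an honest orbit sum;
* `dualDensity Φ = δ̂₁(Φ_m) := m⁴ ⨆_{N ≥ 1} N⁻¹ Σ_{α = ±1} Σ_{1 ≤ n < N} a^α(|Φ̂_m|, n)` ((18));
* `shintaniPartialSum Φ sgn X = N^{sgn}(X, Φ_m) := Σ_{1 ≤ n < X} a^{sgn}(Φ_m, n)` ((17));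
and SPELLS OUT, as parametrized `Prop`s consumed as hypotheses by `FundCubicFieldCountShintaniInput.lean`
(nothing is asserted; this seat may not vendor them as named facts):
* `LandauAverageBound c₁₆ c₁₉ c_L c_U C` — **BTT Theorem 3.2** (Landau's method, averaged; [LDTT]) with the
  constant `C` for families satisfying (16) with constant `c₁₆`, (19) with constant `c₁₉`, and `c_L X ≤ X_i ≤ c_U X`;
  Theorem 3.2 is `∀ c₁₆ c₁₉ c_L c_U > 0, ∃ C, LandauAverageBound c₁₆ c₁₉ c_L c_U C`;
* `DualDensityPsiBound ε C` — **BTT Proposition 5.1** (second definition of `Ψ_{q²}`):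
  `Σ_{q ∈ [Q, 2Q] squarefree} δ̂₁(Ψ_{q²}) ≤ C Q^{2+ε}` for all `Q ≥ 1`; Prop. 5.1 is `∀ ε > 0, ∃ C, DualDensityPsiBound ε C`.

Remarks. (i) `δ̂₁` is invariant under pull-back `V(ℤ/m'ℤ) → V(ℤ/mℤ)`, `m ∣ m'` (the transform of a pull-back
is supported on `(m'/m)·V*` where it is the old transform, the discriminant scales by `(m'/m)⁴`, and the factor
`m⁴` compensates), so `dualDensity (psiMod q)` at level `16q²` is BTT's `δ̂₁(Ψ_{q²})` at level `q²`. (ii) BTT take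
`sup_N` over real `N`; over integers `N` (here) the supremum changes by a factor in `[1/2, 1]`, immaterial in
Theorem 3.2 / Prop. 5.1 (absolute constants). (iii) `⨆` is Mathlib's conditionally complete supremum (`0` if
unbounded); the sequence is bounded (there are `O(N)` orbits with `|Disc| < N`).

## References

* M. Bhargava, T. Taniguchi, F. Thorne, *Improved error estimates for the Davenport–Heilbronn theorems*,
  Math. Ann. 389 (2024) = arXiv:2107.12819, §2.4 (eq:FT), Thm 3.1 (16)–(18), Thm 3.2 (19), Prop. 5.1 [BhargavaTaniguchiThorne2023].
* D. Lowry-Duda, T. Taniguchi, F. Thorne, *Uniform bounds for lattice point counting and partial sums of zeta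
  functions*, Math. Z. 300 (2022) = arXiv:1710.02190, Thm 2, Remark 9 [LowrydudaTaniguchiThorne2017].
* T. Shintani, *On Dirichlet series whose coefficients are class numbers of integral binary cubic forms*,
  J. Math. Soc. Japan 24 (1972), §1 (the alternating form and the dual lattice `L̂`) [Shintani1972].
-/

noncomputable section

open Complex Finset
open Literature.NumberTheory.CubicFields.BinaryCubic

namespace Literature.NumberTheory.CubicFields

variable {m : ℕ}

/-! ### Shintani's pairing and the dual lattice `ι(V*(ℤ)) = {3 ∣ b, 3 ∣ c}` -/

/-- **Shintani's pairing `⟨f, y⟩ = f_d·y_a − (f_c/3)·y_b + (f_b/3)·y_c − f_a·y_d (mod m)`** of an integral form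
`f = ι(x)` in the dual lattice (`3 ∣ f_b, f_c`) with a form `y` over `ℤ/mℤ`: the value `[x, y]` of the dual vector
`x = ι⁻¹ f` on `y`, in the exponent of (eq:FT). (For `f` off the dual lattice the integer divisions make this a
harmless junk value, never used.) [cite: BhargavaTaniguchiThorne2023, §2.4 (the pairing [x, y] of V*(ℤ/mℤ) with V(ℤ/mℤ), via Shintani's ι)] -/
def dualPairing (f : BinaryCubic ℤ) (y : BinaryCubic (ZMod m)) : ZMod m :=
  (f.d : ZMod m) * y.a - ((f.c / 3 : ℤ) : ZMod m) * y.b + ((f.b / 3 : ℤ) : ZMod m) * y.c - (f.a : ZMod m) * y.d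

/-- **The image of `ι : V*(ℤ) ↪ V(ℤ)`**: "those binary cubic forms whose middle two coefficients are divisible
by `3`". [cite: BhargavaTaniguchiThorne2023, §2.4 (the image of ι)] -/
def IsDualForm (f : BinaryCubic ℤ) : Prop :=
  (3 : ℤ) ∣ f.b ∧ (3 : ℤ) ∣ f.c

/-- Membership in the dual lattice is decidable (two divisibilities). [folklore] -/
instance : DecidablePred IsDualForm := fun f =>
  inferInstanceAs (Decidable ((3 : ℤ) ∣ f.b ∧ (3 : ℤ) ∣ f.c))

/-- The pairing with the zero dual vector vanishes. [folklore] -/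
@[simp] theorem dualPairing_zero (y : BinaryCubic (ZMod m)) : dualPairing (0 : BinaryCubic ℤ) y = 0 := by
  simp [dualPairing]

/-- The pairing is odd in `y`: `⟨f, (−1)·y⟩ = −⟨f, y⟩`, where `(−1)·y = twist (−1) y` is the twisted action of
`−1 ∈ GL₂` (which negates every coefficient). [folklore] -/
theorem dualPairing_twist_neg_one (f : BinaryCubic ℤ) (y : BinaryCubic (ZMod m)) :
    dualPairing f (twist (-1) y) = -dualPairing f y := by
  simp only [dualPairing, twist, subst, Matrix.det_fin_two, Matrix.neg_apply, Matrix.one_apply_eq,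
    Matrix.one_apply_ne (show (0 : Fin 2) ≠ 1 by decide), Matrix.one_apply_ne (show (1 : Fin 2) ≠ 0 by decide),
    smul_a, smul_b, smul_c, smul_d]
  ring

/-- The dual lattice is `GL₂(ℤ)`-stable (indeed stable under the twisted action of every integral matrix): the
middle coefficients of `γ·f` are `3·(…)` when those of `f` are. [folklore] -/
theorem IsDualForm.twist {f : BinaryCubic ℤ} (hf : IsDualForm f) (γ : Matrix (Fin 2) (Fin 2) ℤ) :
    IsDualForm (twist γ f) := by
  obtain ⟨⟨β, hβ⟩, ⟨κ, hκ⟩⟩ := hf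
  constructor
  · refine ⟨γ.det * (f.a * γ 0 0 ^ 2 * γ 1 0 + β * (γ 0 0 ^ 2 * γ 1 1 + 2 * γ 0 0 * γ 0 1 * γ 1 0)
      + κ * (2 * γ 0 0 * γ 0 1 * γ 1 1 + γ 0 1 ^ 2 * γ 1 0) + f.d * γ 0 1 ^ 2 * γ 1 1), ?_⟩
    simp only [BinaryCubic.twist, subst, smul_b, hβ, hκ]; ring
  · refine ⟨γ.det * (f.a * γ 0 0 * γ 1 0 ^ 2 + β * (2 * γ 0 0 * γ 1 0 * γ 1 1 + γ 0 1 * γ 1 0 ^ 2)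
      + κ * (γ 0 0 * γ 1 1 ^ 2 + 2 * γ 0 1 * γ 1 0 * γ 1 1) + f.d * γ 0 1 * γ 1 1 ^ 2), ?_⟩
    simp only [BinaryCubic.twist, subst, smul_c, hβ, hκ]; ring

/-- **`⟨γ·f, γ̄·y⟩ = (det γ)⁵ ⟨f, y⟩`**: Shintani's pairing is a relative invariant of the twisted action (8)
(`γ̄ = γ mod m` acting on `V(ℤ/mℤ)`), so that `ι` is `GL₂(ℤ)`-equivariant up to the sign `det γ = ±1`. [folklore] -/
theorem dualPairing_twist {f : BinaryCubic ℤ} (hf : IsDualForm f) (γ : Matrix (Fin 2) (Fin 2) ℤ)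
    (y : BinaryCubic (ZMod m)) :
    dualPairing (twist γ f) (twist (γ.map (Int.castRingHom (ZMod m))) y) =
      ((γ.det ^ 5 : ℤ) : ZMod m) * dualPairing f y := by
  obtain ⟨⟨β, hβ⟩, ⟨κ, hκ⟩⟩ := hf
  have hb3 : (twist γ f).b / 3 = γ.det * (f.a * γ 0 0 ^ 2 * γ 1 0 + β * (γ 0 0 ^ 2 * γ 1 1 + 2 * γ 0 0 * γ 0 1 * γ 1 0)
      + κ * (2 * γ 0 0 * γ 0 1 * γ 1 1 + γ 0 1 ^ 2 * γ 1 0) + f.d * γ 0 1 ^ 2 * γ 1 1) := by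
    have h : (twist γ f).b = 3 * (γ.det * (f.a * γ 0 0 ^ 2 * γ 1 0 + β * (γ 0 0 ^ 2 * γ 1 1 + 2 * γ 0 0 * γ 0 1 * γ 1 0)
      + κ * (2 * γ 0 0 * γ 0 1 * γ 1 1 + γ 0 1 ^ 2 * γ 1 0) + f.d * γ 0 1 ^ 2 * γ 1 1)) := by
      simp only [BinaryCubic.twist, subst, smul_b, hβ, hκ]; ring
    rw [h, Int.mul_ediv_cancel_left _ (by norm_num)]
  have hc3 : (twist γ f).c / 3 = γ.det * (f.a * γ 0 0 * γ 1 0 ^ 2 + β * (2 * γ 0 0 * γ 1 0 * γ 1 1 + γ 0 1 * γ 1 0 ^ 2)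
      + κ * (γ 0 0 * γ 1 1 ^ 2 + 2 * γ 0 1 * γ 1 0 * γ 1 1) + f.d * γ 0 1 * γ 1 1 ^ 2) := by
    have h : (twist γ f).c = 3 * (γ.det * (f.a * γ 0 0 * γ 1 0 ^ 2 + β * (2 * γ 0 0 * γ 1 0 * γ 1 1 + γ 0 1 * γ 1 0 ^ 2)
      + κ * (γ 0 0 * γ 1 1 ^ 2 + 2 * γ 0 1 * γ 1 0 * γ 1 1) + f.d * γ 0 1 * γ 1 1 ^ 2)) := by
      simp only [BinaryCubic.twist, subst, smul_c, hβ, hκ]; ring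
    rw [h, Int.mul_ediv_cancel_left _ (by norm_num)]
  have hfb : f.b / 3 = β := by rw [hβ, Int.mul_ediv_cancel_left _ (by norm_num)]
  have hfc : f.c / 3 = κ := by rw [hκ, Int.mul_ediv_cancel_left _ (by norm_num)]
  have ha : (twist γ f).a = γ.det * (f.a * γ 0 0 ^ 3 + f.b * γ 0 0 ^ 2 * γ 0 1 + f.c * γ 0 0 * γ 0 1 ^ 2 + f.d * γ 0 1 ^ 3) := by
    simp only [BinaryCubic.twist, subst, smul_a]
  have hd : (twist γ f).d = γ.det * (f.a * γ 1 0 ^ 3 + f.b * γ 1 0 ^ 2 * γ 1 1 + f.c * γ 1 0 * γ 1 1 ^ 2 + f.d * γ 1 1 ^ 3) := by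
    simp only [BinaryCubic.twist, subst, smul_d]
  rw [dualPairing, dualPairing, hb3, hc3, hfb, hfc, ha, hd]
  simp only [hβ, hκ, BinaryCubic.twist, subst, smul_a, smul_b, smul_c, smul_d, Matrix.det_fin_two,
    Matrix.map_apply, eq_intCast]
  push_cast
  ring

/-! ### The Fourier transform `Φ̂_m` on the dual lattice, (eq:FT) -/

/-- `e(t/m) = exp(2πi·t/m)` on `ℤ/mℤ` (`t` read in `[0, m)`); for `m ≥ 1` this is Mathlib's standard additive
character `ZMod.stdAddChar` (`eMod_eq_stdAddChar`). Defined without `m ≠ 0` so that `fourierDual`,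
`dualDensity` elaborate at every level. [folklore] -/
def eMod (t : ZMod m) : ℂ :=
  Complex.exp (2 * Real.pi * I * (t.val : ℂ) / (m : ℂ))

/-- `eMod = ZMod.stdAddChar` for `m ≥ 1`. [folklore] -/
theorem eMod_eq_stdAddChar [NeZero m] (t : ZMod m) : eMod t = (ZMod.stdAddChar t : ℂ) := by
  rw [ZMod.stdAddChar_apply, ZMod.toCircle_apply, eMod]

/-- `|e(t/m)| = 1`. [folklore] -/
theorem norm_eMod (t : ZMod m) : ‖eMod t‖ = 1 := by
  rw [eMod, Complex.norm_exp]
  have : (2 * Real.pi * I * (t.val : ℂ) / (m : ℂ)).re = 0 := by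
    rw [show (2 * Real.pi * I * (t.val : ℂ) / (m : ℂ) : ℂ) = ((2 * Real.pi * t.val / m : ℝ) : ℂ) * I by
      push_cast; ring]
    simp
  rw [this, Real.exp_zero]

/-- `e(0) = 1`. [folklore] -/
@[simp] theorem eMod_zero : eMod (0 : ZMod m) = 1 := by
  simp [eMod]

/-- **`Φ̂_m(ι⁻¹ f) = m⁻⁴ Σ_{y ∈ V(ℤ/mℤ)} Φ_m(y) e(⟨f, y⟩/m)`** — the Fourier transform (eq:FT) of `Φ_m`, evaluated
at the dual vector `ι⁻¹ f` (meaningful for `f` in the dual lattice, `IsDualForm f`). A `finsum` (a finite sum for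
`m ≥ 1`, `fourierDual_eq_sum`). [cite: BhargavaTaniguchiThorne2023, §2.4 (eq:FT) (the Fourier transform Φ̂_m)] -/
def fourierDual (Φ : BinaryCubic (ZMod m) → ℂ) (f : BinaryCubic ℤ) : ℂ :=
  ((m : ℂ) ^ 4)⁻¹ * ∑ᶠ y : BinaryCubic (ZMod m), Φ y * eMod (dualPairing f y)

/-- For `m ≥ 1` the transform is the finite sum over `V(ℤ/mℤ)`. [folklore] -/
theorem fourierDual_eq_sum [NeZero m] (Φ : BinaryCubic (ZMod m) → ℂ) (f : BinaryCubic ℤ) :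
    fourierDual Φ f = ((m : ℂ) ^ 4)⁻¹ * ∑ y : BinaryCubic (ZMod m), Φ y * eMod (dualPairing f y) := by
  rw [fourierDual, finsum_eq_sum_of_fintype]

/-- `|V(ℤ/mℤ)| = m⁴`. [folklore] -/
theorem card_binaryCubic_zmod [NeZero m] : Fintype.card (BinaryCubic (ZMod m)) = m ^ 4 := by
  rw [Fintype.card_congr BinaryCubic.equivProd]
  simp only [Fintype.card_prod, ZMod.card]
  ring

/-- **`Φ̂_m(0) = m⁻⁴ Σ_y Φ_m(y) = 𝒜(Φ_m)`, the density of `Φ_m`** (TT_L (8.?): `𝒜_N(f) = Σ_a f(a)/N⁴`). [folklore] -/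
theorem fourierDual_zero_form [NeZero m] (Φ : BinaryCubic (ZMod m) → ℂ) :
    fourierDual Φ 0 = ((m : ℂ) ^ 4)⁻¹ * ∑ y : BinaryCubic (ZMod m), Φ y := by
  rw [fourierDual_eq_sum]
  simp

/-- **`|Φ̂_m(x)| ≤ max |Φ_m|`**: `m⁻⁴ · Σ_{m⁴ terms} |Φ_m(y)| · 1`. [folklore] -/
theorem norm_fourierDual_le [NeZero m] {Φ : BinaryCubic (ZMod m) → ℂ} {B : ℝ} (hΦ : ∀ y, ‖Φ y‖ ≤ B)
    (f : BinaryCubic ℤ) : ‖fourierDual Φ f‖ ≤ B := by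
  have hm : (0 : ℝ) < m := by exact_mod_cast Nat.pos_of_ne_zero (NeZero.ne m)
  rw [fourierDual_eq_sum, norm_mul, norm_inv, norm_pow, Complex.norm_natCast]
  have hsum : ‖∑ y : BinaryCubic (ZMod m), Φ y * eMod (dualPairing f y)‖ ≤ (m : ℝ) ^ 4 * B := by
    calc ‖∑ y : BinaryCubic (ZMod m), Φ y * eMod (dualPairing f y)‖
        ≤ ∑ y : BinaryCubic (ZMod m), ‖Φ y * eMod (dualPairing f y)‖ := norm_sum_le _ _
      _ ≤ ∑ _y : BinaryCubic (ZMod m), B := Finset.sum_le_sum fun y _ => by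
          rw [norm_mul, norm_eMod, mul_one]; exact hΦ y
      _ = (m : ℝ) ^ 4 * B := by
          rw [Finset.sum_const, nsmul_eq_mul, Finset.card_univ, card_binaryCubic_zmod]; push_cast; ring
  calc ((m : ℝ) ^ 4)⁻¹ * ‖∑ y : BinaryCubic (ZMod m), Φ y * eMod (dualPairing f y)‖
      ≤ ((m : ℝ) ^ 4)⁻¹ * ((m : ℝ) ^ 4 * B) := mul_le_mul_of_nonneg_left hsum (by positivity)
    _ = B := by field_simp

/-- The twisted action of a unit-determinant matrix on `V(ℤ/mℤ)` is a bijection (inverse: the action of `γ⁻¹`). [folklore] -/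
def twistEquiv {R : Type*} [CommRing R] (γ : Matrix (Fin 2) (Fin 2) R) (hγ : IsUnit γ.det) :
    BinaryCubic R ≃ BinaryCubic R where
  toFun := twist γ
  invFun := twist γ⁻¹
  left_inv y := by
    rw [← twist_mul, Matrix.nonsing_inv_mul γ hγ, twist_one]
  right_inv y := by
    rw [← twist_mul, Matrix.mul_nonsing_inv γ hγ, twist_one]

/-- `twistEquiv γ hγ y = γ · y`. [folklore] -/
@[simp] theorem twistEquiv_apply {R : Type*} [CommRing R] (γ : Matrix (Fin 2) (Fin 2) R) (hγ : IsUnit γ.det)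
    (y : BinaryCubic R) : twistEquiv γ hγ y = twist γ y := rfl

/-- **`Φ̂_m` is `GL₂(ℤ)`-invariant on the dual lattice** for `GL₂(ℤ/mℤ)`-invariant `Φ_m`:
`Φ̂_m(ι⁻¹(γ·f)) = Φ̂_m(ι⁻¹ f)` (reindex `y ↦ γ̄·y` in (eq:FT) and use `⟨γ·f, γ̄·y⟩ = (det γ)⁵⟨f, y⟩ = ±⟨f, y⟩`; for
`det γ = −1` reindex once more by `y ↦ −y = (−1)·y`). [folklore] -/
theorem fourierDual_twist [NeZero m] {Φ : BinaryCubic (ZMod m) → ℂ}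
    (hΦ : ∀ γ' : Matrix (Fin 2) (Fin 2) (ZMod m), IsUnit γ'.det → ∀ y, Φ (twist γ' y) = Φ y)
    {γ : Matrix (Fin 2) (Fin 2) ℤ} (hγ : IsUnit γ.det) {f : BinaryCubic ℤ} (hf : IsDualForm f) :
    fourierDual Φ (twist γ f) = fourierDual Φ f := by
  have hγ'det : (γ.map (Int.castRingHom (ZMod m))).det = ((γ.det : ℤ) : ZMod m) := by
    rw [← RingHom.mapMatrix_apply, ← RingHom.map_det, eq_intCast]
  have hγ'u : IsUnit (γ.map (Int.castRingHom (ZMod m))).det := by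
    rw [hγ'det]; exact hγ.map (Int.castRingHom (ZMod m))
  rw [fourierDual_eq_sum, fourierDual_eq_sum]
  congr 1
  -- reindex `y = γ̄ · y'`
  rw [← (twistEquiv _ hγ'u).sum_comp]
  simp only [twistEquiv_apply]
  simp_rw [hΦ _ hγ'u, dualPairing_twist hf γ]
  rcases Int.isUnit_iff.mp hγ with h1 | h1
  · simp [h1]
  · -- `det γ = −1`: `e(−⟨f, y⟩) = e(⟨f, −y⟩)`, reindex by `y ↦ (−1)·y`
    simp only [h1, Int.reduceNeg, Int.cast_pow, Int.cast_neg, Int.cast_one]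
    have hneg1 : IsUnit (-1 : Matrix (Fin 2) (Fin 2) (ZMod m)).det := by
      rw [Matrix.det_neg, Matrix.det_one]; simp
    rw [← (twistEquiv (-1 : Matrix (Fin 2) (Fin 2) (ZMod m)) hneg1).sum_comp]
    simp only [twistEquiv_apply]
    refine Finset.sum_congr rfl fun y _ => ?_
    rw [hΦ (-1) hneg1, dualPairing_twist_neg_one]
    congr 2
    ring

/-! ### The dual weight `|Φ̂_m|` on `V(ℤ)` and the dual coefficients `a^±(|Φ̂_m|, n)` -/

/-- **`|Φ̂_m|` as a weight on `V(ℤ)`**: `|Φ̂_m(ι⁻¹ f)|` for `f` in the dual lattice (`3 ∣ b, c`) and `0` for `f`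
not in the image of `ι` ("we write `Φ̂_m(x) = 0` for all `x ∈ V(ℤ)` not in the image of `ι`"). Real, nonnegative,
`GL₂(ℤ)`-invariant for invariant `Φ_m` (`dualWeight_twist`). [cite: BhargavaTaniguchiThorne2023, §2.4 with Thm 3.1 (18) (|Φ̂_m| as a function on V(ℤ) via ι)] -/
def dualWeight (Φ : BinaryCubic (ZMod m) → ℂ) (f : BinaryCubic ℤ) : ℂ :=
  if IsDualForm f then ((‖fourierDual Φ f‖ : ℝ) : ℂ) else 0

/-- The dual weight is a nonnegative real. [folklore] -/
theorem dualWeight_eq_norm (Φ : BinaryCubic (ZMod m) → ℂ) (f : BinaryCubic ℤ) :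
    dualWeight Φ f = ((‖dualWeight Φ f‖ : ℝ) : ℂ) := by
  unfold dualWeight; split_ifs <;> simp

/-- `|dualWeight| ≤ max |Φ_m|`. [folklore] -/
theorem norm_dualWeight_le [NeZero m] {Φ : BinaryCubic (ZMod m) → ℂ} {B : ℝ} (hB : 0 ≤ B) (hΦ : ∀ y, ‖Φ y‖ ≤ B)
    (f : BinaryCubic ℤ) : ‖dualWeight Φ f‖ ≤ B := by
  unfold dualWeight
  split_ifs
  · rw [Complex.norm_real, Real.norm_eq_abs, abs_norm]; exact norm_fourierDual_le hΦ f
  · rwa [norm_zero]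

/-- **The dual weight is `GL₂(ℤ)`-invariant** (for `GL₂(ℤ/mℤ)`-invariant `Φ_m`): it is a class function on
`GL₂(ℤ)`-orbits of `V(ℤ)`, so that the orbit sums below do not depend on representatives. [folklore] -/
theorem dualWeight_twist [NeZero m] {Φ : BinaryCubic (ZMod m) → ℂ}
    (hΦ : ∀ γ' : Matrix (Fin 2) (Fin 2) (ZMod m), IsUnit γ'.det → ∀ y, Φ (twist γ' y) = Φ y)
    {γ : Matrix (Fin 2) (Fin 2) ℤ} (hγ : IsUnit γ.det) (f : BinaryCubic ℤ) :
    dualWeight Φ (twist γ f) = dualWeight Φ f := by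
  by_cases hf : IsDualForm f
  · rw [dualWeight, dualWeight, if_pos hf, if_pos (hf.twist γ), fourierDual_twist hΦ hγ hf]
  · have hf' : ¬ IsDualForm (twist γ f) := by
      intro h
      obtain ⟨δ, hδ⟩ := hγ.exists_right_inv
      have h2 := h.twist γ⁻¹
      rw [← twist_mul, Matrix.nonsing_inv_mul γ hγ, twist_one] at h2
      exact hf h2
    rw [dualWeight, dualWeight, if_neg hf, if_neg hf']

/-- Orbit-invariance in the tree's vocabulary: `GL2ZEquiv f g → dualWeight Φ f = dualWeight Φ g`. [folklore] -/
theorem dualWeight_eq_of_gl2zEquiv [NeZero m] {Φ : BinaryCubic (ZMod m) → ℂ}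
    (hΦ : ∀ γ' : Matrix (Fin 2) (Fin 2) (ZMod m), IsUnit γ'.det → ∀ y, Φ (twist γ' y) = Φ y)
    {f g : BinaryCubic ℤ} (h : GL2ZEquiv f g) : dualWeight Φ f = dualWeight Φ g := by
  obtain ⟨γ, hγ, rfl⟩ := h
  exact (dualWeight_twist hΦ hγ f).symm

/-- **`a^α(|Φ̂_m|, n) := Σ_{x ∈ GL₂(ℤ)\V(ℤ), Disc(x) = α n} |Φ̂_m(x)|/|Stab(x)|`** (`Φ̂_m` on `V(ℤ)` via `ι`, `0` off
the image) — the coefficients of the dual zeta function of `|Φ̂_m|` entering (18); the tree's weighted orbit sum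
`shintaniCoeffWith` with the weight `dualWeight Φ`. [cite: BhargavaTaniguchiThorne2023, Thm 3.1 (18) (the coefficients a^α(|Φ̂_m|, n))] -/
def dualAbsCoeff (Φ : BinaryCubic (ZMod m) → ℂ) (α : ℤ) (n : ℕ) : ℂ :=
  shintaniCoeffWith (dualWeight Φ) (α * n)

/-- A weighted orbit sum with nonnegative real weights is a nonnegative real. [folklore] -/
theorem shintaniCoeffWith_re_nonneg {w : BinaryCubic ℤ → ℂ} (hw : ∀ f, 0 ≤ (w f).re ∧ (w f).im = 0) (D : ℤ) :
    0 ≤ (shintaniCoeffWith w D).re ∧ (shintaniCoeffWith w D).im = 0 := by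
  unfold shintaniCoeffWith
  refine finsum_induction (fun z : ℂ => 0 ≤ z.re ∧ z.im = 0) (by simp) (fun x y hx hy => ?_) (fun O => ?_)
  · simp only [Complex.add_re, Complex.add_im, hx.2, hy.2, add_zero, and_true]; exact add_nonneg hx.1 hy.1
  · obtain ⟨hre, him⟩ := hw (orbitRep O)
    rw [← Complex.ofReal_natCast, Complex.div_ofReal_re, Complex.div_ofReal_im, him, zero_div]
    exact ⟨div_nonneg hre (Nat.cast_nonneg _), rfl⟩

/-- The dual coefficients `a^α(|Φ̂_m|, n)` are nonnegative reals. [folklore] -/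
theorem dualAbsCoeff_re_nonneg (Φ : BinaryCubic (ZMod m) → ℂ) (α : ℤ) (n : ℕ) :
    0 ≤ (dualAbsCoeff Φ α n).re ∧ (dualAbsCoeff Φ α n).im = 0 :=
  shintaniCoeffWith_re_nonneg (fun f => by rw [dualWeight_eq_norm Φ f]; simp) _

/-- **`δ̂₁(Φ_m) := m⁴ · sup_N N⁻¹ Σ_{α ∈ {±}} Σ_{n < N} a^α(|Φ̂_m|, n)`** (BTT Thm 3.1 (18)), the supremum over
integers `N ≥ 1` of the mean density of the dual coefficients (real parts; the coefficients are nonnegative reals).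
[cite: BhargavaTaniguchiThorne2023, Thm 3.1 (18) (δ̂₁(Φ_m))] -/
def dualDensity (Φ : BinaryCubic (ZMod m) → ℂ) : ℝ :=
  (m : ℝ) ^ 4 * ⨆ N : ℕ, (N : ℝ)⁻¹ * ∑ n ∈ Finset.Ico 1 N, ((dualAbsCoeff Φ 1 n).re + (dualAbsCoeff Φ (-1) n).re)

/-- `δ̂₁(Φ_m) ≥ 0`. [folklore] -/
theorem dualDensity_nonneg (Φ : BinaryCubic (ZMod m) → ℂ) : 0 ≤ dualDensity Φ := by
  unfold dualDensity
  refine mul_nonneg (by positivity) (Real.iSup_nonneg fun N => mul_nonneg (by positivity) ?_)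
  exact Finset.sum_nonneg fun n _ => add_nonneg (dualAbsCoeff_re_nonneg Φ 1 n).1 (dualAbsCoeff_re_nonneg Φ (-1) n).1

/-- **`N^{sgn}(X, Φ_m) := Σ_{n < X} a^{sgn}(Φ_m, n)`** (BTT Thm 3.1 (17)), for real `X` (`n` over `1 ≤ n < X`). [cite: BhargavaTaniguchiThorne2023, Thm 3.1 (17) (N^±(X, Φ_m))] -/
def shintaniPartialSum (Φ : BinaryCubic (ZMod m) → ℂ) (sgn : ℤ) (X : ℝ) : ℂ :=
  ∑ n ∈ Finset.Ico 1 ⌈X⌉₊, shintaniCoeffMod Φ sgn n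

/-- At an integer `X`: `N^{sgn}(X, Φ_m) = Σ_{1 ≤ n < X} a^{sgn}(Φ_m, n)`. [folklore] -/
theorem shintaniPartialSum_natCast (Φ : BinaryCubic (ZMod m) → ℂ) (sgn : ℤ) (X : ℕ) :
    shintaniPartialSum Φ sgn (X : ℝ) = ∑ n ∈ Finset.Ico 1 X, shintaniCoeffMod Φ sgn n := by
  rw [shintaniPartialSum, Nat.ceil_natCast]

/-- In particular `N^s(X, Ψ_{q²}) = nonFundCount s q X`, the tree's sieve count (via
`nonFundCount_eq_sum_shintaniCoeffMod`). [folklore] -/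
theorem shintaniPartialSum_psiMod {s : ℤ} (hs : s = 1 ∨ s = -1) (q X : ℕ) :
    shintaniPartialSum (psiMod q) s (X : ℝ) = ((nonFundCount s q X : ℝ) : ℂ) := by
  rw [shintaniPartialSum_natCast, nonFundCount_eq_sum_shintaniCoeffMod hs]

/-! ### Theorem 3.2 and Proposition 5.1 as hypothesis schemas -/

/-- **Bhargava–Taniguchi–Thorne 2023, Theorem 3.2 (the averaged form of Landau's method, via [LDTT]) with the
constant `C`, for families satisfying (16) with constant `c₁₆`, (19) with constant `c₁₉` and `c_L X ≤ X_i ≤ c_U X`** —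
a PARAMETRIZED `Prop` used as a hypothesis (`∀ c₁₆ c₁₉ c_L c_U > 0, ∃ C, LandauAverageBound …` is Theorem 3.2;
nothing is asserted here). As printed: "Keeping the notation of Theorem 3.1 [`Φ_m : V(ℤ/mℤ) → ℂ` nonnegative and
`GL₂(ℤ/mℤ)`-invariant, `δ₁(Φ_m) := Res_{s=1} ξ^±(s, Φ_m)`, `δ̂₁(Φ_m) := m⁴ sup_N N⁻¹ Σ_α Σ_{n<N} a^α(|Φ̂_m|, n)`,
`N^±(X, Φ_m) := Σ_{n<X} a^±(Φ_m, n)`], consider an arbitrary finite set of pairs `(Φ_{m_i}, X_i)_{i ∈ I}`, where each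
`Φ_{m_i}` is a function satisfying the hypotheses of Theorem 3.1 other than (17) [i.e. (16):
`|Res_{s=5/6} ξ^±| ≪ X^{1/6} |Res_{s=1} ξ^±|`], and each `X_i` is a positive real number with `X_i ≍ X` for some
fixed `X`. Then `Σ_{i∈I} |N^±(X_i, Φ_{m_i}) − Σ_{σ ∈ {1, 5/6}} (X_i^σ/σ) Res_{s=σ} ξ^±(s, Φ_{m_i})|
≪ X^{3/5} (Σ_i δ₁(Φ_{m_i}))^{3/5} (Σ_i δ̂₁(Φ_{m_i}))^{2/5}` provided that (19) `Σ_i δ̂₁(Φ_{m_i}) ≪ X Σ_i δ₁(Φ_{m_i})`."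
Here per sign `sgn = ±1`, with the residues `shintaniRes1/56` of the continuation (`ShintaniZetaResidues.lean`),
`δ̂₁ = dualDensity`, `N^± = shintaniPartialSum`, families indexed by a `Finset` of any type, and `X ≥ 1`.
[cite: BhargavaTaniguchiThorne2023, Thm 3.2 with Thm 3.1 (16)–(19)] -/
def LandauAverageBound (c₁₆ c₁₉ cL cU C : ℝ) : Prop :=
  ∀ (sgn : ℤ), (sgn = 1 ∨ sgn = -1) →
  ∀ (ι : Type) (I : Finset ι) (m : ι → ℕ) (Φ : ∀ i, BinaryCubic (ZMod (m i)) → ℂ) (Xf : ι → ℝ) (X : ℝ),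
    1 ≤ X →
    (∀ i ∈ I, 0 < m i) →
    (∀ i ∈ I, ∀ y, 0 ≤ (Φ i y).re ∧ (Φ i y).im = 0) →
    (∀ i ∈ I, ∀ γ : Matrix (Fin 2) (Fin 2) (ZMod (m i)), IsUnit γ.det → ∀ y, Φ i (twist γ y) = Φ i y) →
    (∀ i ∈ I, cL * X ≤ Xf i ∧ Xf i ≤ cU * X) →
    (∀ i ∈ I, ‖shintaniRes56 (Φ i) sgn‖ ≤ c₁₆ * X ^ ((1 : ℝ) / 6) * ‖shintaniRes1 (Φ i) sgn‖) →
    (∑ i ∈ I, dualDensity (Φ i) ≤ c₁₉ * X * ∑ i ∈ I, (shintaniRes1 (Φ i) sgn).re) →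
    ∑ i ∈ I, ‖shintaniPartialSum (Φ i) sgn (Xf i) - shintaniRes1 (Φ i) sgn * (Xf i : ℂ)
        - (6 / 5 : ℂ) * shintaniRes56 (Φ i) sgn * (((Xf i) ^ ((5 : ℝ) / 6) : ℝ) : ℂ)‖
      ≤ C * X ^ ((3 : ℝ) / 5) * (∑ i ∈ I, (shintaniRes1 (Φ i) sgn).re) ^ ((3 : ℝ) / 5)
          * (∑ i ∈ I, dualDensity (Φ i)) ^ ((2 : ℝ) / 5)

/-- **Bhargava–Taniguchi–Thorne 2023, Proposition 5.1 (second definition of `Ψ_{q²}`: nonmaximal at `p` or a triple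
root mod `p`, at every `p ∣ q`) with exponent `ε` and constant `C`** — a PARAMETRIZED `Prop` used as a hypothesis
(`∀ ε > 0, ∃ C, DualDensityPsiBound ε C` is Proposition 5.1; nothing is asserted here). As printed: "For either
definition of `Ψ_{q²}`, we have `Σ_{q ∈ [Q, 2Q]} δ̂₁(Ψ_{q²}) ≪ Q^{2+ε}`" (summation over squarefree `q`; `Q ≥ 1`;
`δ̂₁(Ψ_{q²}) = dualDensity (psiMod q)`, level `16q²`, which is BTT's `δ̂₁` at level `q²` by pull-back invariance).
Its proof uses Prop. 5.2 (the Fourier transforms `Ψ̂_{p²}` of Taniguchi–Thorne), Lemma 2.3, Prop. 4.4 and Prop. 4.5.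
[cite: BhargavaTaniguchiThorne2023, Prop. 5.1 (second definition of Ψ_{q²})] -/
def DualDensityPsiBound (ε C : ℝ) : Prop :=
  ∀ Q : ℕ, 1 ≤ Q →
    ∑ q ∈ (Finset.Icc Q (2 * Q)).filter Squarefree, dualDensity (psiMod q) ≤ C * (Q : ℝ) ^ (2 + ε)

end Literature.NumberTheory.CubicFields

end
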